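import Mathlib
import Summits.MatrixMultiplication.MatrixMultiplication.Theorems.AutomaticSTPPDesignsAutomaticPackingThesisPrattVal
import Literature.Combinatorics.Additive.TripleProductProperty
import Literature.Computability.AlgebraicComplexity.PrattTrapezoidVal
import Literature.Computability.AlgebraicComplexity.PrattTrapezoidValSTPP

/-!
# Local-USP designs in cyclic groups (CKSU 2005 Thm. 6.6 over coprime moduli) and the growth
# exponent of Pratt's `Val(ℤ/nℤ)` — general lemmas

Support file for route `MatrixMultiplication/AutomaticSTPPDesigns`, crux
`stmt-MatrixMultiplication-7356` (`AutomaticPackingThesis`); companion of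
`AutomaticSTPPDesignsAutomaticPackingThesisPrattValExponent.lean` (`PrattValExponent.prattVal_ge_rpow`,
exponent `log 9792/log 5814 = 1.0601…` from the CKSU two-triple design).  This file re-hosts a larger
print construction in cyclic groups — Cohn–Kleinberg–Szegedy–Umans 2005, Thm. 6.6 (local USPs /
`H`-charts) over PAIRWISE COPRIME moduli — and isolates the generic passage from an STPP digit
design to a growth exponent of `Val(ℤ/nℤ)`; the explicit design (exponent `1.0803`) is the companion
file `…PrattValLocalUSPDesign.lean`, and the Coppersmith–Winograd design of the tree
(`AutomaticDesignBelowFourFifths_proof`) is read for mass in `…PrattValCW.lean` (exponent `7/6`).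

* `addSimultaneousTPP_piFinset_of_chart` — CKSU Thm. 6.6 in product form over coordinate groups
  `G_j` that may differ (charts of TPP symbol triples; a code all of whose non-constant ordered row
  triples have a witness coordinate ⇒ the product sets form an STPP family in `∏_j G_j`); the proof
  is the paper's, coordinatewise.
* `localUSPChart_witness`, `localUSPChart_tpp`, `localUSPChart_card` — the `ℤ/ℓ`-chart of CKSU §6.3
  (`A(1),B(1),C(1) = {0},-Ĥ,{0}`; `A(2),B(2),C(2) = {1},{0},Ĥ`; `A(3),B(3),C(3) = Ĥ,{0},{0}`,
  `Ĥ = ℤ/ℓ ∖ {0,1}`): the seven local-USP patterns are witnesses, each symbol triple is TPP of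
  volume `ℓ - 2`.
* `exists_digitDesign_of_localUSP` — a local USP `U ⊆ {1,2,3}^k` of size `s` over pairwise coprime
  moduli `ℓ_1, …, ℓ_k ≥ 3` is an STPP digit design in the CYCLIC group `ℤ/(ℓ_1⋯ℓ_k)` (Chinese
  remainder isomorphism = a sum-reflecting map, tree lemma `addSimultaneousTPP_image_of_reflect`)
  with `s` triples of volume `∏_j (ℓ_j - 2)`.  (Distinct coprime moduli are what make the host
  cyclic without carries; one base `ℤ/ℓ^k` would need carry-robust digits, cf. `stub_chartSTPP`.)
* `pow_le_prattVal_of_digitDesign`, `prattVal_ge_rpow_of_digitDesign` — generic: an STPP digit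
  design of mass `m > N` in `ℤ/N` (`N ≥ 2`) powers losslessly inside the `N`-tower
  (`addSimultaneousTPP_digitBox`) and gives `Val(ℤ/nℤ) ≥ (6N)^{-σ} n^σ` for all `n ≥ 1`,
  `σ = log m / log N` (Pratt Prop. 3.3 / 4.3 via `sum_card_le_prattVal_of_three_mul_le`).

## References

* H. Cohn, R. Kleinberg, B. Szegedy, C. Umans, *Group-theoretic algorithms for matrix
  multiplication*, FOCS 2005, arXiv:math/0511460: Def. 5.1 (STPP), §6.3 (local USPs, Def. 6.5
  charts, Thm. 6.6), Lemma 5.4.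
* K. Pratt, *On generalized corners and matrix multiplication*, ITCS 2024, arXiv:2309.03878:
  Def. 3.2, Prop. 3.3, Prop. 4.3, Thm. 4.7.
-/

-- single-conjunct summit: the mandated namespace repeats `MatrixMultiplication`.
set_option linter.dupNamespace false

noncomputable section

namespace Summit.MatrixMultiplication.MatrixMultiplication.Theorems

namespace PrattValLocalUSP

open Finset Literature.Combinatorics.Additive Literature.Computability.AlgebraicComplexity
  AutomaticPackingThesis

/-! ### CKSU 2005, Thm. 6.6 (charts) over a product of possibly different abelian groups -/

/-- **Cohn–Kleinberg–Szegedy–Umans 2005, Thm. 6.6 (Def. 6.5, `H`-charts), product form over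
coordinate groups `G_j` that may differ.** Let every coordinate `j` carry a chart
`x ↦ (A_j(x), B_j(x), C_j(x))` of symbol triples with the triple product property in `G_j`, and let
`U` be a code (`s` rows, `k` coordinates) in which every ordered triple of rows `(u, v, w)`, not all
equal, has a *witness coordinate* `j` with `0 ∉ A_j(u_j) - A_j(v_j) + B_j(v_j) - B_j(w_j) + C_j(w_j) - C_j(u_j)`.
Then the product sets `A_u = ∏_j A_j(u_j)`, `B_u = ∏_j B_j(u_j)`, `C_u = ∏_j C_j(u_j)` form an STPP
family (CKSU Def. 5.1, the tree's `AddSimultaneousTPP`) in `∏_j G_j`: the witness coordinate kills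
clause (ii), and clause (i) holds coordinatewise. [cite: CohnKleinbergSzegedyUmans2005, Thm. 6.6] -/
theorem addSimultaneousTPP_piFinset_of_chart {k : ℕ} {G : Fin k → Type*}
    [∀ j, AddCommGroup (G j)] [∀ j, DecidableEq (G j)] {Γ : Type*}
    (A B C : (j : Fin k) → Γ → Finset (G j))
    (htpp : ∀ j x, AddTripleProductProperty (A j x) (B j x) (C j x))
    {s : ℕ} (U : Fin s → Fin k → Γ)
    (hU : ∀ i i' i'' : Fin s, (i = i' ∧ i' = i'') ∨ ∃ j : Fin k,
      ∀ a ∈ A j (U i j), ∀ a' ∈ A j (U i' j), ∀ b ∈ B j (U i' j), ∀ b' ∈ B j (U i'' j),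
        ∀ c ∈ C j (U i'' j), ∀ c' ∈ C j (U i j), a + -a' + b + -b' + c + -c' ≠ 0) :
    AddSimultaneousTPP (fun i => Fintype.piFinset fun j => A j (U i j))
      (fun i => Fintype.piFinset fun j => B j (U i j))
      (fun i => Fintype.piFinset fun j => C j (U i j)) := by
  refine ⟨fun i => ?_, fun i i' i'' a ha a' ha' b hb b' hb' c hc c' hc' e => ?_⟩
  · intro a ha a' ha' b hb b' hb' c hc c' hc' e
    simp only [Fintype.mem_piFinset] at ha ha' hb hb' hc hc'
    have hco : ∀ j, a j = a' j ∧ b j = b' j ∧ c j = c' j := fun j =>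
      htpp j (U i j) (a j) (ha j) (a' j) (ha' j) (b j) (hb j) (b' j) (hb' j) (c j) (hc j)
        (c' j) (hc' j) (by simpa using congrFun e j)
    exact ⟨funext fun j => (hco j).1, funext fun j => (hco j).2.1, funext fun j => (hco j).2.2⟩
  · rcases hU i i' i'' with h | ⟨j, hj⟩
    · exact h
    · exfalso
      simp only [Fintype.mem_piFinset] at ha ha' hb hb' hc hc'
      exact hj (a j) (ha j) (a' j) (ha' j) (b j) (hb j) (b' j) (hb' j) (c j) (hc j) (c' j)
        (hc' j) (by simpa using congrFun e j)

/-! ### The local-USP chart of CKSU 2005, §6.3 in `ℤ/ℓ` -/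

section chart

variable {ℓ : ℕ} [NeZero ℓ]

/-- **Witness patterns of the local-USP chart** (CKSU 2005, §6.3, the `ℤ/ℓ`-chart before Thm. 6.6
with `Ĥ = ℤ/ℓ ∖ {0,1}`: `A(1) = {0}, B(1) = -Ĥ, C(1) = {0}`; `A(2) = {1}, B(2) = {0}, C(2) = Ĥ`;
`A(3) = Ĥ, B(3) = {0}, C(3) = {0}`; symbols written `0,1,2`): for each of the seven local-USP
patterns `(x,y,z) ∈ {(1,2,1),(1,2,2),(1,1,3),(1,3,3),(2,2,3),(3,2,3),(1,2,3)}` one has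
`0 ∉ A(x) - A(y) + B(y) - B(z) + C(z) - C(x)` in `ℤ/ℓ`, `ℓ ≥ 2`.
[cite: CohnKleinbergSzegedyUmans2005, §6.3] -/
theorem localUSPChart_witness (h1 : (1 : ZMod ℓ) ≠ 0) {x y z : Fin 3}
    (h : (x, y, z) ∈ ({(0, 1, 0), (0, 1, 1), (0, 0, 2), (0, 2, 2), (1, 1, 2), (2, 1, 2), (0, 1, 2)} :
      Finset (Fin 3 × Fin 3 × Fin 3))) :
    ∀ a ∈ (![{0}, {1}, univ \ {0, 1}] : Fin 3 → Finset (ZMod ℓ)) x,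
    ∀ a' ∈ (![{0}, {1}, univ \ {0, 1}] : Fin 3 → Finset (ZMod ℓ)) y,
    ∀ b ∈ (![(univ \ {0, 1}).image Neg.neg, {0}, {0}] : Fin 3 → Finset (ZMod ℓ)) y,
    ∀ b' ∈ (![(univ \ {0, 1}).image Neg.neg, {0}, {0}] : Fin 3 → Finset (ZMod ℓ)) z,
    ∀ c ∈ (![{0}, univ \ {0, 1}, {0}] : Fin 3 → Finset (ZMod ℓ)) z,
    ∀ c' ∈ (![{0}, univ \ {0, 1}, {0}] : Fin 3 → Finset (ZMod ℓ)) x,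
      a + -a' + b + -b' + c + -c' ≠ 0 := by
  have mem_hat : ∀ {u : ZMod ℓ}, u ∈ (univ \ {0, 1} : Finset (ZMod ℓ)) ↔ u ≠ 0 ∧ u ≠ 1 := by
    intro u; simp
  simp only [mem_insert, mem_singleton, Prod.mk.injEq] at h
  rcases h with ⟨rfl, rfl, rfl⟩ | ⟨rfl, rfl, rfl⟩ | ⟨rfl, rfl, rfl⟩ | ⟨rfl, rfl, rfl⟩ |
    ⟨rfl, rfl, rfl⟩ | ⟨rfl, rfl, rfl⟩ | ⟨rfl, rfl, rfl⟩
  all_goals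
    intro a ha a' ha' b hb b' hb' c hc c' hc'
    simp only [Matrix.cons_val_zero, Matrix.cons_val_one, Matrix.cons_val,
      mem_singleton, mem_image, mem_hat] at ha ha' hb hb' hc hc'
  · -- (1,2,1): 0 - 1 + 0 - (-h) + 0 - 0 = h - 1 with h ∈ Ĥ
    obtain ⟨h, ⟨-, hh1⟩, rfl⟩ := hb'
    subst ha ha' hb hc hc'
    intro e; apply hh1; linear_combination e
  · -- (1,2,2): 0 - 1 + 0 - 0 + h - 0
    subst ha ha' hb hb' hc'
    intro e; apply hc.2; linear_combination e
  · -- (1,1,3): 0 - 0 + (-h) - 0 + 0 - 0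
    obtain ⟨h, ⟨hh0, -⟩, rfl⟩ := hb
    subst ha ha' hb' hc hc'
    intro e; apply hh0; linear_combination -e
  · -- (1,3,3): 0 - h + 0 - 0 + 0 - 0
    subst ha hb hb' hc hc'
    intro e; apply ha'.1; linear_combination -e
  · -- (2,2,3): 1 - 1 + 0 - 0 + 0 - h
    subst ha ha' hb hb' hc
    intro e; apply hc'.1; linear_combination -e
  · -- (3,2,3): h - 1 + 0 - 0 + 0 - 0
    subst ha' hb hb' hc hc'
    intro e; apply ha.2; linear_combination e
  · -- (1,2,3): 0 - 1 + 0 - 0 + 0 - 0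
    subst ha ha' hb hb' hc hc'
    intro e; apply h1; linear_combination -e

/-- **Each symbol triple of the local-USP chart has the triple product property** (two of its
three sets are singletons). [cite: CohnKleinbergSzegedyUmans2005, §6.3] -/
theorem localUSPChart_tpp (x : Fin 3) :
    AddTripleProductProperty ((![{0}, {1}, univ \ {0, 1}] : Fin 3 → Finset (ZMod ℓ)) x)
      ((![(univ \ {0, 1}).image Neg.neg, {0}, {0}] : Fin 3 → Finset (ZMod ℓ)) x)
      ((![{0}, univ \ {0, 1}, {0}] : Fin 3 → Finset (ZMod ℓ)) x) := by
  intro a ha a' ha' b hb b' hb' c hc c' hc' e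
  fin_cases x
  all_goals
    simp only [Matrix.cons_val_zero, Matrix.cons_val_one, Matrix.cons_val,
      mem_singleton, Fin.zero_eta, Fin.mk_one, Fin.reduceFinMk] at ha ha' hb hb' hc hc'
  · subst ha ha' hc hc'
    refine ⟨rfl, ?_, rfl⟩
    have : b + -b' = 0 := by simpa using e
    rwa [add_neg_eq_zero] at this
  · subst ha ha' hb hb'
    refine ⟨rfl, rfl, ?_⟩
    have : c + -c' = 0 := by simpa using e
    rwa [add_neg_eq_zero] at this
  · subst hb hb' hc hc'
    refine ⟨?_, rfl, rfl⟩
    have : a + -a' = 0 := by simpa using e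
    rwa [add_neg_eq_zero] at this

/-- **Volume of a chart symbol**: `|A(x)||B(x)||C(x)| = ℓ - 2` for each of the three symbols
(`|Ĥ| = ℓ - 2` for `ℓ ≥ 2`, the other two sets are singletons).
[cite: CohnKleinbergSzegedyUmans2005, §6.3] -/
theorem localUSPChart_card (hℓ : 2 ≤ ℓ) (x : Fin 3) :
    #((![{0}, {1}, univ \ {0, 1}] : Fin 3 → Finset (ZMod ℓ)) x) *
      #((![(univ \ {0, 1}).image Neg.neg, {0}, {0}] : Fin 3 → Finset (ZMod ℓ)) x) *
      #((![{0}, univ \ {0, 1}, {0}] : Fin 3 → Finset (ZMod ℓ)) x) = ℓ - 2 := by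
  have hhat : #(univ \ {0, 1} : Finset (ZMod ℓ)) = ℓ - 2 := by
    have h01 : (0 : ZMod ℓ) ≠ 1 := by
      haveI : Fact (1 < ℓ) := ⟨by omega⟩
      exact zero_ne_one
    rw [card_sdiff_of_subset (subset_univ _), card_univ, ZMod.card, card_pair h01]
  have himg : #((univ \ {0, 1} : Finset (ZMod ℓ)).image Neg.neg) = ℓ - 2 := by
    rw [card_image_of_injective _ neg_injective, hhat]
  fin_cases x <;> simp [hhat, himg]

end chart

/-! ### Local USP codes over pairwise coprime moduli: STPP digit designs in one cyclic group -/

/-- **A local USP code over pairwise coprime moduli is an STPP digit design in the cyclic group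
`ℤ/(∏_j ℓ_j)`** (CKSU 2005, Thm. 6.6 with the local-USP chart in `∏_j ℤ/ℓ_j`, transported along the
Chinese remainder isomorphism, a sum-reflecting map; hypotheses: `ℓ_j ≥ 3` pairwise coprime, and
`U ⊆ {1,2,3}^k` — symbols written `0,1,2` — is a local USP: every ordered triple of rows, not all
equal, shows one of the patterns `(1,2,1),(1,2,2),(1,1,3),(1,3,3),(2,2,3),(3,2,3),(1,2,3)` in some
coordinate). The design lives in `ℤ/N`, `N = ∏_j ℓ_j`, as digit sets in `Fin N`, and has `s` triples, each of
volume `V = ∏_j (ℓ_j - 2)` (total mass `s·V`). [cite: CohnKleinbergSzegedyUmans2005, Thm. 6.6] -/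
theorem exists_digitDesign_of_localUSP {k : ℕ} (ℓ : Fin k → ℕ) (hℓ : ∀ j, 3 ≤ ℓ j)
    (hcop : Pairwise fun i j => Nat.Coprime (ℓ i) (ℓ j)) {s : ℕ} (U : Fin s → Fin k → Fin 3)
    (hU : ∀ i i' i'' : Fin s, (i = i' ∧ i' = i'') ∨ ∃ j : Fin k, (U i j, U i' j, U i'' j) ∈
      ({(0, 1, 0), (0, 1, 1), (0, 0, 2), (0, 2, 2), (1, 1, 2), (2, 1, 2), (0, 1, 2)} :
        Finset (Fin 3 × Fin 3 × Fin 3)))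
    {N V : ℕ} (hN : ∏ j, ℓ j = N) (hV : ∏ j, (ℓ j - 2) = V) :
    ∃ DA DB DC : Fin s → Finset (Fin N),
    AddSimultaneousTPP
      (fun i => (DA i).image fun d : Fin N => ((d : ℕ) : ZMod N))
      (fun i => (DB i).image fun d : Fin N => ((d : ℕ) : ZMod N))
      (fun i => (DC i).image fun d : Fin N => ((d : ℕ) : ZMod N)) ∧
    ∀ i, #(DA i) * #(DB i) * #(DC i) = V := by
  classical
  subst hN hV
  haveI : ∀ j, NeZero (ℓ j) := fun j => ⟨by have := hℓ j; omega⟩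
  set N : ℕ := ∏ j, ℓ j with hN
  haveI : NeZero N := ⟨by rw [hN]; exact prod_ne_zero_iff.2 fun j _ => NeZero.ne _⟩
  -- the Chinese remainder isomorphism, as a sum-reflecting map into `ℤ/N`
  let e : ZMod N ≃+* Π j, ZMod (ℓ j) := ZMod.prodEquivPi ℓ hcop
  set φ : (Π j, ZMod (ℓ j)) → ZMod N := fun x => e.symm x with hφdef
  have hφ : ∀ a b c a' b' c', φ a + φ b + φ c = φ a' + φ b' + φ c' → a + b + c = a' + b' + c' := by
    intro a b c a' b' c' h
    have := congrArg e h
    simpa [hφdef] using this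
  have hφinj : Function.Injective φ := fun x y h => by simpa [hφdef] using h
  -- read the elements of `ℤ/N` as digits `Fin N`
  obtain ⟨ψ, hψ⟩ : ∃ ψ : (Π j, ZMod (ℓ j)) → Fin N, ∀ x, (((ψ x : Fin N) : ℕ) : ZMod N) = φ x :=
    ⟨fun x => ⟨(φ x).val, ZMod.val_lt _⟩, fun x => ZMod.natCast_zmod_val (φ x)⟩
  have hψinj : Function.Injective ψ := fun x y h => hφinj (by rw [← hψ x, ← hψ y, h])
  have himg : ∀ S : Finset (Π j, ZMod (ℓ j)),
      (S.image ψ).image (fun d : Fin N => ((d : ℕ) : ZMod N)) = S.image φ := by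
    intro S
    rw [Finset.image_image]
    exact Finset.image_congr fun x _ => hψ x
  -- the chart, coordinatewise
  let cA : (j : Fin k) → Fin 3 → Finset (ZMod (ℓ j)) := fun j => ![{0}, {1}, univ \ {0, 1}]
  let cB : (j : Fin k) → Fin 3 → Finset (ZMod (ℓ j)) :=
    fun j => ![(univ \ {0, 1}).image Neg.neg, {0}, {0}]
  let cC : (j : Fin k) → Fin 3 → Finset (ZMod (ℓ j)) := fun j => ![{0}, univ \ {0, 1}, {0}]
  have h1 : ∀ j, (1 : ZMod (ℓ j)) ≠ 0 := by
    intro j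
    haveI : Fact (1 < ℓ j) := ⟨by have := hℓ j; omega⟩
    exact one_ne_zero
  have design : AddSimultaneousTPP (fun i => Fintype.piFinset fun j => cA j (U i j))
      (fun i => Fintype.piFinset fun j => cB j (U i j))
      (fun i => Fintype.piFinset fun j => cC j (U i j)) := by
    refine addSimultaneousTPP_piFinset_of_chart cA cB cC (fun j x => localUSPChart_tpp x) U ?_
    intro i i' i''
    rcases hU i i' i'' with h | ⟨j, hj⟩
    · exact Or.inl h
    · exact Or.inr ⟨j, localUSPChart_witness (h1 j) hj⟩
  refine ⟨fun i => (Fintype.piFinset fun j => cA j (U i j)).image ψ,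
    fun i => (Fintype.piFinset fun j => cB j (U i j)).image ψ,
    fun i => (Fintype.piFinset fun j => cC j (U i j)).image ψ, ?_, ?_⟩
  · simp only [himg]
    exact addSimultaneousTPP_image_of_reflect design φ hφ
  · intro i
    simp only [card_image_of_injective _ hψinj, Fintype.card_piFinset, ← prod_mul_distrib]
    exact prod_congr rfl fun j _ => localUSPChart_card (by have := hℓ j; omega) (U i j)

/-! ### From a digit design to the growth exponent of `Val(ℤ/nℤ)` -/

/-- **Digit designs power losslessly and bound `Val` at every larger modulus**: an STPP digit
design of mass `m` in `ℤ/N` gives `m^k ≤ Val(ℤ/M)` for every `M ≥ 3·N^k` (digit boxes at scale `k`,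
tree lemmas `addSimultaneousTPP_digitBox`, `sum_card_digitBox`, and the transfer
`sum_card_le_prattVal_of_three_mul_le` = Pratt Prop. 3.3 / 4.3). [cite: Pratt2024, Prop. 3.3 and Prop. 4.3] -/
theorem pow_le_prattVal_of_digitDesign {N s m : ℕ} [NeZero N] (DA DB DC : Fin s → Finset (Fin N))
    (hD : AddSimultaneousTPP
      (fun i => (DA i).image fun d : Fin N => ((d : ℕ) : ZMod N))
      (fun i => (DB i).image fun d : Fin N => ((d : ℕ) : ZMod N))
      (fun i => (DC i).image fun d : Fin N => ((d : ℕ) : ZMod N)))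
    (hm : ∑ i, #(DA i) * #(DB i) * #(DC i) = m) (k M : ℕ) [NeZero M] (hM : 3 * N ^ k ≤ M) :
    m ^ k ≤ prattVal (ZMod M) := by
  classical
  haveI : NeZero (N ^ k) := ⟨pow_ne_zero _ (NeZero.ne N)⟩
  have hS := addSimultaneousTPP_digitBox DA DB DC hD k
  have h := sum_card_le_prattVal_of_three_mul_le hS hM
  rwa [sum_card_digitBox DA DB DC k, hm] at h

/-- **The exponent from a digit design**: an STPP digit design of mass `m > N` in `ℤ/N` (`N ≥ 2`)
gives `Val(ℤ/nℤ) ≥ K · n^{log m / log N}` for all `n ≥ 1`, with `K = (6N)^{-log m/log N}`: for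
`n ≥ 3N` take `N^k ≤ n/3 < N^{k+1}`, so `Val(ℤ/nℤ) ≥ m^k = (N^k)^σ ≥ (n/(6N))^σ`; for `n < 3N`,
`Val(ℤ/nℤ) ≥ n ≥ (n/(6N))^σ`. [folklore] -/
theorem prattVal_ge_rpow_of_digitDesign {N s m : ℕ} (hN : 2 ≤ N) (hNm : N < m)
    (DA DB DC : Fin s → Finset (Fin N))
    (hD : haveI : NeZero N := ⟨by omega⟩; AddSimultaneousTPP
      (fun i => (DA i).image fun d : Fin N => ((d : ℕ) : ZMod N))
      (fun i => (DB i).image fun d : Fin N => ((d : ℕ) : ZMod N))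
      (fun i => (DC i).image fun d : Fin N => ((d : ℕ) : ZMod N)))
    (hm : ∑ i, #(DA i) * #(DB i) * #(DC i) = m) :
    ∃ K : ℝ, 0 < K ∧ ∀ (n : ℕ) (_ : NeZero n),
      K * (n : ℝ) ^ (Real.log m / Real.log N) ≤ (prattVal (ZMod n) : ℝ) := by
  haveI : NeZero N := ⟨by omega⟩
  have hNR : (1 : ℝ) < N := by exact_mod_cast (by omega : 1 < N)
  have hNpos : (0 : ℝ) < N := by linarith
  have hmR : (N : ℝ) < m := by exact_mod_cast hNm
  have hlogb : 0 < Real.log N := Real.log_pos hNR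
  have hlogm : Real.log N < Real.log m := Real.log_lt_log hNpos hmR
  set σ : ℝ := Real.log m / Real.log N with hσ
  have h1σ : 1 < σ := by
    rw [hσ, lt_div_iff₀ hlogb, one_mul]
    exact hlogm
  have hσpos : 0 < σ := by linarith
  -- `N^σ = m`, hence `(N^k)^σ = m^k`
  have hpow : ∀ k : ℕ, (((N ^ k : ℕ) : ℕ) : ℝ) ^ σ = ((m ^ k : ℕ) : ℝ) := by
    intro k
    have hbm : (N : ℝ) ^ σ = m := by
      rw [Real.rpow_def_of_pos hNpos]
      have : Real.log N * σ = Real.log m := by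
        rw [hσ]; field_simp
      rw [this, Real.exp_log (by linarith)]
    push_cast
    rw [← Real.rpow_natCast, ← Real.rpow_mul hNpos.le, mul_comm, Real.rpow_mul hNpos.le, hbm,
      Real.rpow_natCast]
  have h6N : (0 : ℝ) < 6 * N := by positivity
  refine ⟨(1 / (6 * N) : ℝ) ^ σ, Real.rpow_pos_of_pos (by positivity) _, ?_⟩
  intro n hn
  have hn1 : 1 ≤ n := Nat.one_le_iff_ne_zero.2 (NeZero.ne n)
  have hnR : (1 : ℝ) ≤ n := by exact_mod_cast hn1
  have hK : (1 / (6 * N) : ℝ) ^ σ * (n : ℝ) ^ σ = ((n : ℝ) / (6 * N)) ^ σ := by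
    rw [← Real.mul_rpow (by positivity) (by positivity)]
    congr 1
    ring
  rw [hK]
  by_cases hsmall : n < 3 * N
  · -- small moduli: `Val ≥ |G| = n ≥ n/(6N) ≥ (n/(6N))^σ`
    have hle1 : (n : ℝ) / (6 * N) ≤ 1 := by
      rw [div_le_one h6N]
      exact_mod_cast (by omega : n ≤ 6 * N)
    have hpos : 0 < (n : ℝ) / (6 * N) := by positivity
    calc ((n : ℝ) / (6 * N)) ^ σ ≤ ((n : ℝ) / (6 * N)) ^ (1 : ℝ) :=
          Real.rpow_le_rpow_of_exponent_ge hpos hle1 h1σ.le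
      _ = (n : ℝ) / (6 * N) := Real.rpow_one _
      _ ≤ n := by
          rw [div_le_iff₀ h6N]
          nlinarith
      _ = (Fintype.card (ZMod n) : ℝ) := by rw [ZMod.card]
      _ ≤ (prattVal (ZMod n) : ℝ) := by exact_mod_cast card_le_prattVal
  · -- large moduli: `N^k ≤ n/3 < N^(k+1)`
    push Not at hsmall
    set k : ℕ := Nat.log N (n / 3) with hk
    have hn3 : n / 3 ≠ 0 := by omega
    have hlow : N ^ k ≤ n / 3 := Nat.pow_log_le_self N hn3
    have hup : n / 3 < N ^ (k + 1) := Nat.lt_pow_succ_log_self (by omega) _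
    have h3 : 3 * N ^ k ≤ n := by omega
    have hval := pow_le_prattVal_of_digitDesign DA DB DC hD hm k n h3
    have hnb : (n : ℝ) / (6 * N) ≤ (((N ^ k : ℕ) : ℕ) : ℝ) := by
      rw [div_le_iff₀ h6N]
      have : n ≤ N ^ k * (6 * N) := by
        have h' : n < 3 * N ^ (k + 1) + 3 := by omega
        rw [pow_succ] at h'
        have hNk : 1 ≤ N ^ k * N := Nat.one_le_iff_ne_zero.2 (by positivity)
        nlinarith
      exact_mod_cast this
    calc ((n : ℝ) / (6 * N)) ^ σ ≤ (((N ^ k : ℕ) : ℕ) : ℝ) ^ σ :=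
          Real.rpow_le_rpow (by positivity) hnb hσpos.le
      _ = ((m ^ k : ℕ) : ℝ) := hpow k
      _ ≤ (prattVal (ZMod n) : ℝ) := by exact_mod_cast hval

end PrattValLocalUSP

end Summit.MatrixMultiplication.MatrixMultiplication.Theorems

end
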